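import Literature.Probability.Percolation.TwoClusterGibbsJointCovarianceMeasure
import HarnessLib

/-!
# Covariances along the two-cluster Gibbs sampler of van den Berg–Häggström–Kahn (2006), §2.1 — the multi-marker
# form with a HUB TEST `1{Σ ↔ s}·1{Σ ↮ X}` (reduction theorem for the mixed conditioned slack hierarchy)

Topic `Literature/Probability/Percolation`; specialisation of `BHK2006_clusterJointTestCov_nonneg_of_within`
(`TwoClusterGibbsJointCovarianceMeasure.lean`) to the joint test
`h(C_s, C_X) = Σ_{u∈T} c(u)·1{s ↔ u} + c₀·1{Σ ↔ s}·1{Σ ↮ X}`, `c₀ ≥ 0`, exactly parallel to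
`BHK2006_multiMarkerCov_nonneg_of_within` of `TwoClusterGibbsCovariance.lean` (markers only).  ALL declarations are
theorems (no named fact).  The hub test is the observation indicator of an observer `o` GLUED to the vertex set `Σ`
("`o ∈ C_s` and `s ↮ X` in the glued graph, given `s ↮ X`"), the device by which the `prim` cell's proof of
Kozma–Nitzan's Question 9 (arXiv:2401.12397 §5.5; seat memo run/shared/lean/prim/prim-ineq-gen-7/PROOF-Q9-MIXED-CSH.md
§3.1 "Lemma T, mixed", Q9-WRITEUP.md Lemma 6.1) integrates the open star of the observer; it is increasing in `C_s` and
DECREASING in the cluster of `X`, so with `c₀ ≥ 0` the joint test is decreasing in the conditioning cluster and the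
joint-test reduction theorem applies (the extra cross term of the `X`-half-step has the right sign by Harris).

`BHK2006_multiMarkerHubCov_nonneg_of_within` (fixed weights `w`, `w e < 1` on the non-loop pairs meeting `X`): IF for
every monotone nonnegative `g`
`0 ≤ ∫_D ( Σ_u c(u)·[∫_{s↔u} g dμ_{w^ω} − (∫ g dμ_{w^ω}) μ_{w^ω}(s↔u)] + c₀·1{Σ↮X}(ω)·[∫_{Σ↔s} g dμ_{w^ω} − (∫ g dμ_{w^ω}) μ_{w^ω}(Σ↔s)] ) dμ(ω)`
(`w^ω` the weights zeroed on the pairs meeting the open vertex cluster of `X`; in the world `ω` the avoidance factor of the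
hub test is frozen and the factor `1{Σ ↔ s}` is a marker of the fresh cluster), THEN for every monotone `f`
`0 ≤ Σ_u c(u)·[μ(D)∫_{D∩{s↔u}} f − (∫_D f) μ(D∩{s↔u})] + c₀·[μ(D)∫_{D∩Hub} f − (∫_D f) μ(D∩Hub)]`, `Hub = {Σ↔s}∩{Σ↮X}`.
Not here: several hub tests, negative hub coefficients (false in general), degenerate-weight closure.
[cite: VandenbergHaggstromKahn2005, §2.1 pp. 9–13 (Lemma 2.4, the chain)] [cite: KozmaNitzan2024, Question 9 (§5.5 p. 36)]
-/

noncomputable section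

open MeasureTheory unitInterval
open Literature.Probability.LatticeModels (prodBernoulli)

namespace Literature.Probability.Percolation

/-! ### The multi-marker form with a HUB test (the shape of the MIXED conditioned slack hierarchy)

The mixed conditioned slack hierarchy of the `prim` cell's proof of Kozma–Nitzan's Question 9 (seat memo
prim-ineq-gen-7/PROOF-Q9-MIXED-CSH.md §3.1, "Lemma T, mixed") replaces ONE observation indicator `1{s ↔ o}`
by the HUB TEST `1{Σ ∩ C_s ≠ ∅}·1{Σ ↮ X}` of a vertex set `Σ` (the observer glued to `Σ`): a product of an
increasing function of `C_s` and a DECREASING function of the cluster of the avoided set `X`, entering the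
margin with a nonnegative coefficient.  The joint-test reduction theorem applies: the extra cross term has
the right sign. -/

section Hub

variable {V : Type*} [Fintype V]

open scoped Classical
open BHK2006 DecisionTree

/-- `1{∃ z ∈ Σ, z = s ∨ z ∈ V(C_s)}` read on the edge cluster is the indicator of `{∃ z ∈ Σ, s ↔ z}`.
[cite: VandenbergHaggstromKahn2005, §1 p. 3 ("A simple example of such an event is {s ↔ a}")] -/
theorem BHK2006.ite_hub_openEdgeCluster_eq_indicator (ω : BondConfig V) (s : V) (Sig : Set V) :
    (if (∃ z ∈ Sig, z = s ∨ ∃ e ∈ openEdgeCluster ω s, z ∈ e) then (1 : ℝ) else 0) =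
      ({η : BondConfig V | ∃ z ∈ Sig, (openGraph η).Reachable s z}).indicator 1 ω := by
  by_cases hω : ∃ z ∈ Sig, (openGraph ω).Reachable s z
  · have h' : ∃ z ∈ Sig, z = s ∨ ∃ e ∈ openEdgeCluster ω s, z ∈ e := by
      obtain ⟨z, hz, hr⟩ := hω
      exact ⟨z, hz, (reachable_iff_exists_mem_openEdgeCluster ω s z).1 hr⟩
    rw [if_pos h', Set.indicator_of_mem
      (show ω ∈ {η : BondConfig V | ∃ z ∈ Sig, (openGraph η).Reachable s z} from hω), Pi.one_apply]
  · have h' : ¬ ∃ z ∈ Sig, z = s ∨ ∃ e ∈ openEdgeCluster ω s, z ∈ e := by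
      rintro ⟨z, hz, hh⟩
      exact hω ⟨z, hz, (reachable_iff_exists_mem_openEdgeCluster ω s z).2 hh⟩
    rw [if_neg h', Set.indicator_of_notMem
      (show ω ∉ {η : BondConfig V | ∃ z ∈ Sig, (openGraph η).Reachable s z} from hω)]

/-- `1{∀ z ∈ Σ, z ∉ X ∪ V(C_X)}` read on the set cluster is `1{Σ ↮ X}`.
[cite: VandenbergHaggstromKahn2005, §2.1 p. 9 (definition of `C_S`)] -/
theorem BHK2006.ite_hubAvoid_setCl_eq (ω : BondConfig V) (X : Set V) (Sig : Set V) :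
    (if (∀ z ∈ Sig, ¬ (z ∈ X ∨ ∃ e ∈ setCl ω X, z ∈ e)) then (1 : ℝ) else 0) =
      if (∀ z ∈ Sig, ∀ x ∈ X, ¬ (openGraph ω).Reachable x z) then (1 : ℝ) else 0 := by
  have hiff : (∀ z ∈ Sig, ¬ (z ∈ X ∨ ∃ e ∈ setCl ω X, z ∈ e)) ↔
      ∀ z ∈ Sig, ∀ x ∈ X, ¬ (openGraph ω).Reachable x z := by
    refine forall₂_congr fun z _ => ?_
    rw [← setReach_iff ω X z]
    exact ⟨fun h x hx hr => h ⟨x, hx, hr⟩, fun h ⟨x, hx, hr⟩ => h x hx hr⟩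
  simp only [hiff]

/-- `∫_D F · 1_A = ∫_{D ∩ A} F`. [folklore] -/
private theorem setIntegral_mul_indicator_one' (μ : Measure (BondConfig V)) (D A : Set (BondConfig V))
    (F : BondConfig V → ℝ) :
    ∫ ω in D, F ω * A.indicator 1 ω ∂μ = ∫ ω in D ∩ A, F ω ∂μ := by
  have hA : MeasurableSet A := MeasurableSet.of_discrete
  have e : (fun ω => F ω * A.indicator (1 : BondConfig V → ℝ) ω) = A.indicator F := by
    funext ω
    by_cases hω : ω ∈ A
    · rw [Set.indicator_of_mem hω, Set.indicator_of_mem hω, Pi.one_apply, mul_one]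
    · rw [Set.indicator_of_notMem hω, Set.indicator_of_notMem hω, mul_zero]
  rw [e, setIntegral_indicator hA]

/-- `∫ F · 1_A = ∫_A F`. [folklore] -/
private theorem integral_mul_indicator_one' (μ : Measure (BondConfig V)) (A : Set (BondConfig V))
    (F : BondConfig V → ℝ) :
    ∫ ω, F ω * A.indicator 1 ω ∂μ = ∫ ω in A, F ω ∂μ := by
  have h := setIntegral_mul_indicator_one' μ Set.univ A F
  rwa [Measure.restrict_univ, Set.univ_inter] at h

/-- The hub bookkeeping, fresh-configuration side: with the joint test
`H(C, B) = Σ_{u∈T} c(u)·χ_u(C) + c₀·1{Σ meets {s} ∪ V(C)}·1{Σ misses X ∪ V(B)}`,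
`E_η[(gH)(C_s(η∖A_X ω), C_X ω)] − E_η[g]E_η[H] = Σ_u c(u)·[…χ_u…] + c₀·1{Σ ↮ X}(ω)·[∫_{Σ↔s} g dμ_{w^ω} − (∫ g dμ_{w^ω}) μ_{w^ω}(Σ ↔ s)]`,
`w^ω` the weights zeroed on the pairs meeting the cluster of `X`. [cite: VandenbergHaggstromKahn2005, §2.1 Lemma 2.4 (p. 10)] -/
private theorem hub_fresh_eq (w : Sym2 V → unitInterval) (s : V) (X : Set V) (T : Finset V)
    (c : V → ℝ) (Sig : Set V) (c₀ : ℝ) (g : Set (Sym2 V) → ℝ) (ω : BondConfig V) :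
    ((∫ η, g (openEdgeCluster (η \ {e | ∃ v ∈ e, ∃ x ∈ X, (openGraph ω).Reachable x v}) s) *
          (fun (C B : Set (Sym2 V)) => (∑ u ∈ T, c u * (if (u = s ∨ ∃ e ∈ C, u ∈ e) then (1 : ℝ) else 0)) +
              c₀ * ((if (∃ z ∈ Sig, z = s ∨ ∃ e ∈ C, z ∈ e) then (1 : ℝ) else 0) *
                (if (∀ z ∈ Sig, ¬ (z ∈ X ∨ ∃ e ∈ B, z ∈ e)) then (1 : ℝ) else 0)))
            (openEdgeCluster (η \ {e | ∃ v ∈ e, ∃ x ∈ X, (openGraph ω).Reachable x v}) s) (setCl ω X)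
          ∂(prodBernoulli w)) -
      (∫ η, g (openEdgeCluster (η \ {e | ∃ v ∈ e, ∃ x ∈ X, (openGraph ω).Reachable x v}) s)
          ∂(prodBernoulli w)) *
      (∫ η, (fun (C B : Set (Sym2 V)) => (∑ u ∈ T, c u * (if (u = s ∨ ∃ e ∈ C, u ∈ e) then (1 : ℝ) else 0)) +
              c₀ * ((if (∃ z ∈ Sig, z = s ∨ ∃ e ∈ C, z ∈ e) then (1 : ℝ) else 0) *
                (if (∀ z ∈ Sig, ¬ (z ∈ X ∨ ∃ e ∈ B, z ∈ e)) then (1 : ℝ) else 0)))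
            (openEdgeCluster (η \ {e | ∃ v ∈ e, ∃ x ∈ X, (openGraph ω).Reachable x v}) s) (setCl ω X)
          ∂(prodBernoulli w))) =
    (∑ u ∈ T, c u * ((∫ η in (openConn s u : Set (BondConfig V)), g (openEdgeCluster η s)
            ∂(prodBernoulli fun e => if (∃ v ∈ e, ∃ x ∈ X, (openGraph ω).Reachable x v)
              then (0 : unitInterval) else w e)) -
          (∫ η, g (openEdgeCluster η s)
            ∂(prodBernoulli fun e => if (∃ v ∈ e, ∃ x ∈ X, (openGraph ω).Reachable x v)
              then (0 : unitInterval) else w e)) *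
          (prodBernoulli fun e => if (∃ v ∈ e, ∃ x ∈ X, (openGraph ω).Reachable x v)
              then (0 : unitInterval) else w e).real (openConn s u : Set (BondConfig V)))) +
      c₀ * ((if (∀ z ∈ Sig, ∀ x ∈ X, ¬ (openGraph ω).Reachable x z) then (1 : ℝ) else 0) *
        ((∫ η in {η : BondConfig V | ∃ z ∈ Sig, (openGraph η).Reachable s z}, g (openEdgeCluster η s)
            ∂(prodBernoulli fun e => if (∃ v ∈ e, ∃ x ∈ X, (openGraph ω).Reachable x v)
              then (0 : unitInterval) else w e)) -
          (∫ η, g (openEdgeCluster η s)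
            ∂(prodBernoulli fun e => if (∃ v ∈ e, ∃ x ∈ X, (openGraph ω).Reachable x v)
              then (0 : unitInterval) else w e)) *
          (prodBernoulli fun e => if (∃ v ∈ e, ∃ x ∈ X, (openGraph ω).Reachable x v)
              then (0 : unitInterval) else w e).real
            {η : BondConfig V | ∃ z ∈ Sig, (openGraph η).Reachable s z})) := by
  set wX : Sym2 V → unitInterval := fun e => if (∃ v ∈ e, ∃ x ∈ X, (openGraph ω).Reachable x v)
    then (0 : unitInterval) else w e with hwX
  set q : ℝ := (if (∀ z ∈ Sig, ∀ x ∈ X, ¬ (openGraph ω).Reachable x z) then (1 : ℝ) else 0) with hq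
  set Hs : Set (BondConfig V) := {η | ∃ z ∈ Sig, (openGraph η).Reachable s z} with hHs
  set H : Set (Sym2 V) → Set (Sym2 V) → ℝ := fun C B =>
    (∑ u ∈ T, c u * (if (u = s ∨ ∃ e ∈ C, u ∈ e) then (1 : ℝ) else 0)) +
      c₀ * ((if (∃ z ∈ Sig, z = s ∨ ∃ e ∈ C, z ∈ e) then (1 : ℝ) else 0) *
        (if (∀ z ∈ Sig, ¬ (z ∈ X ∨ ∃ e ∈ B, z ∈ e)) then (1 : ℝ) else 0)) with hH
  have hHω : ∀ η : BondConfig V, H (openEdgeCluster η s) (setCl ω X) =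
      (∑ u ∈ T, c u * (openConn s u : Set (BondConfig V)).indicator 1 η) +
        (c₀ * q) * Hs.indicator 1 η := fun η => by
    simp only [hH, ite_mem_openEdgeCluster_eq_indicator, ite_hub_openEdgeCluster_eq_indicator,
      ite_hubAvoid_setCl_eq, hq, hHs]
    ring
  have h0 : ∀ e ∈ {e : Sym2 V | ∃ v ∈ e, ∃ x ∈ X, (openGraph ω).Reachable x v}, wX e = 0 :=
    fun e he => by simp only [hwX]; exact if_pos he
  have h1 : ∀ e ∉ {e : Sym2 V | ∃ v ∈ e, ∃ x ∈ X, (openGraph ω).Reachable x v}, wX e = w e :=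
    fun e he => by simp only [hwX]; exact if_neg he
  have splitU : ∀ G : BondConfig V → ℝ, ∫ η, G η * H (openEdgeCluster η s) (setCl ω X) ∂(prodBernoulli wX) =
      (∑ u ∈ T, c u * (∫ η in openConn s u, G η ∂(prodBernoulli wX))) +
        (c₀ * q) * (∫ η in Hs, G η ∂(prodBernoulli wX)) := by
    intro G
    have e1 : (fun η => G η * H (openEdgeCluster η s) (setCl ω X)) = fun η =>
        (∑ u ∈ T, c u * (G η * (openConn s u : Set (BondConfig V)).indicator 1 η)) +
          (c₀ * q) * (G η * Hs.indicator 1 η) := by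
      funext η
      rw [hHω, mul_add, Finset.mul_sum]
      congr 1
      · exact Finset.sum_congr rfl fun u _ => by ring
      · ring
    rw [e1, integral_add (Integrable.of_finite) (Integrable.of_finite),
      integral_finsetSum _ fun u _ => Integrable.of_finite, integral_const_mul, integral_mul_indicator_one']
    congr 1
    exact Finset.sum_congr rfl fun u _ => by rw [integral_const_mul, integral_mul_indicator_one']
  have massU : ∫ η, H (openEdgeCluster η s) (setCl ω X) ∂(prodBernoulli wX) =
      (∑ u ∈ T, c u * (prodBernoulli wX).real (openConn s u : Set (BondConfig V))) +
        (c₀ * q) * (prodBernoulli wX).real Hs := by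
    have h2 := splitU (fun _ => (1 : ℝ))
    simp only [one_mul] at h2
    rw [h2]
    congr 1
    · exact Finset.sum_congr rfl fun u _ => by rw [setIntegral_const, smul_eq_mul, mul_one]
    · rw [setIntegral_const, smul_eq_mul, mul_one]
  rw [integral_comp_sdiff_prodBernoulli' w wX _ h0 h1
      (fun η => g (openEdgeCluster η s) * H (openEdgeCluster η s) (setCl ω X)),
    integral_comp_sdiff_prodBernoulli' w wX _ h0 h1 (fun η => g (openEdgeCluster η s)),
    integral_comp_sdiff_prodBernoulli' w wX _ h0 h1 (fun η => H (openEdgeCluster η s) (setCl ω X)),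
    splitU, massU, mul_add, Finset.mul_sum]
  have e3 : ∑ u ∈ T, c u * ((∫ η in (openConn s u : Set (BondConfig V)), g (openEdgeCluster η s)
        ∂(prodBernoulli wX)) - (∫ η, g (openEdgeCluster η s) ∂(prodBernoulli wX)) *
          (prodBernoulli wX).real (openConn s u : Set (BondConfig V))) =
      (∑ u ∈ T, c u * (∫ η in (openConn s u : Set (BondConfig V)), g (openEdgeCluster η s)
        ∂(prodBernoulli wX))) -
        ∑ u ∈ T, (∫ η, g (openEdgeCluster η s) ∂(prodBernoulli wX)) *
          (c u * (prodBernoulli wX).real (openConn s u : Set (BondConfig V))) := by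
    rw [← Finset.sum_sub_distrib]
    exact Finset.sum_congr rfl fun u _ => by ring
  rw [e3]
  ring

/-- The hub bookkeeping, conclusion side: with the same joint test `H`,
`μ(D)∫_D f·H(C_s, C_X) − (∫_D f)(∫_D H) = Σ_u c(u)·[μ(D)∫_{D∩{s↔u}} f − (∫_D f) μ(D∩{s↔u})] + c₀·[μ(D)∫_{D ∩ Hub} f − (∫_D f) μ(D ∩ Hub)]`,
`Hub = {Σ ↔ s} ∩ {Σ ↮ X}`. [folklore] -/
private theorem hub_conclusion_eq (w : Sym2 V → unitInterval) (s : V) (X : Set V) (T : Finset V)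
    (c : V → ℝ) (Sig : Set V) (c₀ : ℝ) (f : Set (Sym2 V) → ℝ) :
    (prodBernoulli w).real {ω : BondConfig V | ∀ x ∈ X, ¬ (openGraph ω).Reachable s x} *
        (∫ ω in {ω : BondConfig V | ∀ x ∈ X, ¬ (openGraph ω).Reachable s x},
          f (openEdgeCluster ω s) *
            (fun (C B : Set (Sym2 V)) => (∑ u ∈ T, c u * (if (u = s ∨ ∃ e ∈ C, u ∈ e) then (1 : ℝ) else 0)) +
              c₀ * ((if (∃ z ∈ Sig, z = s ∨ ∃ e ∈ C, z ∈ e) then (1 : ℝ) else 0) *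
                (if (∀ z ∈ Sig, ¬ (z ∈ X ∨ ∃ e ∈ B, z ∈ e)) then (1 : ℝ) else 0)))
              (openEdgeCluster ω s) (setCl ω X) ∂(prodBernoulli w)) -
      (∫ ω in {ω : BondConfig V | ∀ x ∈ X, ¬ (openGraph ω).Reachable s x},
          f (openEdgeCluster ω s) ∂(prodBernoulli w)) *
        (∫ ω in {ω : BondConfig V | ∀ x ∈ X, ¬ (openGraph ω).Reachable s x},
          (fun (C B : Set (Sym2 V)) => (∑ u ∈ T, c u * (if (u = s ∨ ∃ e ∈ C, u ∈ e) then (1 : ℝ) else 0)) +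
              c₀ * ((if (∃ z ∈ Sig, z = s ∨ ∃ e ∈ C, z ∈ e) then (1 : ℝ) else 0) *
                (if (∀ z ∈ Sig, ¬ (z ∈ X ∨ ∃ e ∈ B, z ∈ e)) then (1 : ℝ) else 0)))
            (openEdgeCluster ω s) (setCl ω X) ∂(prodBernoulli w)) =
    (∑ u ∈ T, c u * ((prodBernoulli w).real {ω : BondConfig V | ∀ x ∈ X, ¬ (openGraph ω).Reachable s x} *
          (∫ ω in {ω : BondConfig V | ∀ x ∈ X, ¬ (openGraph ω).Reachable s x} ∩ openConn s u,
            f (openEdgeCluster ω s) ∂(prodBernoulli w)) -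
        (∫ ω in {ω : BondConfig V | ∀ x ∈ X, ¬ (openGraph ω).Reachable s x},
            f (openEdgeCluster ω s) ∂(prodBernoulli w)) *
          (prodBernoulli w).real
            ({ω : BondConfig V | ∀ x ∈ X, ¬ (openGraph ω).Reachable s x} ∩ openConn s u))) +
      c₀ * ((prodBernoulli w).real {ω : BondConfig V | ∀ x ∈ X, ¬ (openGraph ω).Reachable s x} *
          (∫ ω in {ω : BondConfig V | ∀ x ∈ X, ¬ (openGraph ω).Reachable s x} ∩
              {ω | (∃ z ∈ Sig, (openGraph ω).Reachable s z) ∧ ∀ z ∈ Sig, ∀ x ∈ X, ¬ (openGraph ω).Reachable x z},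
            f (openEdgeCluster ω s) ∂(prodBernoulli w)) -
        (∫ ω in {ω : BondConfig V | ∀ x ∈ X, ¬ (openGraph ω).Reachable s x},
            f (openEdgeCluster ω s) ∂(prodBernoulli w)) *
          (prodBernoulli w).real ({ω : BondConfig V | ∀ x ∈ X, ¬ (openGraph ω).Reachable s x} ∩
            {ω | (∃ z ∈ Sig, (openGraph ω).Reachable s z) ∧ ∀ z ∈ Sig, ∀ x ∈ X, ¬ (openGraph ω).Reachable x z})) := by
  set μ := prodBernoulli w with hμ
  set D : Set (BondConfig V) := {ω | ∀ x ∈ X, ¬ (openGraph ω).Reachable s x} with hDdef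
  set Hub : Set (BondConfig V) :=
    {ω | (∃ z ∈ Sig, (openGraph ω).Reachable s z) ∧ ∀ z ∈ Sig, ∀ x ∈ X, ¬ (openGraph ω).Reachable x z} with hHub
  set H : Set (Sym2 V) → Set (Sym2 V) → ℝ := fun C B =>
    (∑ u ∈ T, c u * (if (u = s ∨ ∃ e ∈ C, u ∈ e) then (1 : ℝ) else 0)) +
      c₀ * ((if (∃ z ∈ Sig, z = s ∨ ∃ e ∈ C, z ∈ e) then (1 : ℝ) else 0) *
        (if (∀ z ∈ Sig, ¬ (z ∈ X ∨ ∃ e ∈ B, z ∈ e)) then (1 : ℝ) else 0)) with hH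
  have hind : ∀ η : BondConfig V,
      ({η : BondConfig V | ∃ z ∈ Sig, (openGraph η).Reachable s z}).indicator (1 : BondConfig V → ℝ) η *
        (if (∀ z ∈ Sig, ∀ x ∈ X, ¬ (openGraph η).Reachable x z) then (1 : ℝ) else 0) =
      Hub.indicator 1 η := by
    intro η
    by_cases h1 : ∃ z ∈ Sig, (openGraph η).Reachable s z
    · by_cases h2 : ∀ z ∈ Sig, ∀ x ∈ X, ¬ (openGraph η).Reachable x z
      · rw [Set.indicator_of_mem
          (show η ∈ {η' : BondConfig V | ∃ z ∈ Sig, (openGraph η').Reachable s z} from h1), if_pos h2,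
          Set.indicator_of_mem (show η ∈ Hub from ⟨h1, h2⟩)]
        simp
      · rw [if_neg h2, Set.indicator_of_notMem (show η ∉ Hub from fun h => h2 h.2), mul_zero]
    · rw [Set.indicator_of_notMem
        (show η ∉ {η' : BondConfig V | ∃ z ∈ Sig, (openGraph η').Reachable s z} from h1),
        Set.indicator_of_notMem (show η ∉ Hub from fun h => h1 h.1), zero_mul]
  have hHω : ∀ η : BondConfig V, H (openEdgeCluster η s) (setCl η X) =
      (∑ u ∈ T, c u * (openConn s u : Set (BondConfig V)).indicator 1 η) + c₀ * Hub.indicator 1 η := by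
    intro η
    simp only [hH, ite_mem_openEdgeCluster_eq_indicator, ite_hub_openEdgeCluster_eq_indicator,
      ite_hubAvoid_setCl_eq, hind η]
  have split : ∀ G : BondConfig V → ℝ, ∫ ω in D, G ω * H (openEdgeCluster ω s) (setCl ω X) ∂μ =
      (∑ u ∈ T, c u * (∫ ω in D ∩ openConn s u, G ω ∂μ)) + c₀ * (∫ ω in D ∩ Hub, G ω ∂μ) := by
    intro G
    have e1 : (fun ω => G ω * H (openEdgeCluster ω s) (setCl ω X)) = fun ω =>
        (∑ u ∈ T, c u * (G ω * (openConn s u : Set (BondConfig V)).indicator 1 ω)) +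
          c₀ * (G ω * Hub.indicator 1 ω) := by
      funext ω
      rw [hHω, mul_add, Finset.mul_sum]
      congr 1
      · exact Finset.sum_congr rfl fun u _ => by ring
      · ring
    rw [e1, integral_add (Integrable.of_finite) (Integrable.of_finite),
      integral_finsetSum _ fun u _ => Integrable.of_finite, integral_const_mul, setIntegral_mul_indicator_one']
    congr 1
    exact Finset.sum_congr rfl fun u _ => by rw [integral_const_mul, setIntegral_mul_indicator_one']
  have massD : ∫ ω in D, H (openEdgeCluster ω s) (setCl ω X) ∂μ =
      (∑ u ∈ T, c u * μ.real (D ∩ openConn s u)) + c₀ * μ.real (D ∩ Hub) := by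
    have h2 := split (fun _ => (1 : ℝ))
    simp only [one_mul] at h2
    rw [h2]
    congr 1
    · exact Finset.sum_congr rfl fun u _ => by rw [setIntegral_const, smul_eq_mul, mul_one]
    · rw [setIntegral_const, smul_eq_mul, mul_one]
  rw [split, massD, mul_add, mul_add, Finset.mul_sum, Finset.mul_sum]
  have e3 : ∑ u ∈ T, c u * (μ.real D * (∫ ω in D ∩ openConn s u, f (openEdgeCluster ω s) ∂μ) -
        (∫ ω in D, f (openEdgeCluster ω s) ∂μ) * μ.real (D ∩ openConn s u)) =
      (∑ u ∈ T, μ.real D * (c u * ∫ ω in D ∩ openConn s u, f (openEdgeCluster ω s) ∂μ)) -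
        ∑ u ∈ T, (∫ ω in D, f (openEdgeCluster ω s) ∂μ) * (c u * μ.real (D ∩ openConn s u)) := by
    rw [← Finset.sum_sub_distrib]
    exact Finset.sum_congr rfl fun u _ => by ring
  rw [e3]
  ring

/-- **Reduction theorem, multi-marker form with a hub test, FIXED weights** (the shape of the mixed
conditioned slack hierarchy: Lemma T with the observer glued to a vertex set).  Bond percolation
`μ = prodBernoulli w` on a finite vertex type; a source `s`, an avoided set `X` with `w e < 1` on the non-loop
pairs meeting `X`; markers `u ∈ T` with constant coefficients `c(u)` (any signs) and tests `1{s ↔ u}`; a hub set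
`Σ` with coefficient `c₀ ≥ 0` and the HUB TEST `1{Σ ↔ s}·1{Σ ↮ X}`; `D = {s ↮ X}`; for each `ω` the ZEROED
weights `w^ω` on the pairs meeting the open vertex cluster of `X`.  If for every monotone nonnegative `g`
`0 ≤ ∫_D ( Σ_{u∈T} c(u)·[∫_{s↔u} g(C_s) dμ_{w^ω} − (∫ g(C_s) dμ_{w^ω}) μ_{w^ω}(s↔u)]`
`        + c₀·1{Σ ↮ X}(ω)·[∫_{Σ↔s} g(C_s) dμ_{w^ω} − (∫ g(C_s) dμ_{w^ω}) μ_{w^ω}(Σ↔s)] ) dμ(ω)`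
(in the world `ω` the factor `1{Σ ↮ X}` of the hub test is frozen and the factor `1{Σ ↔ s}` is a marker of
the fresh cluster), then for every monotone `f`
`0 ≤ Σ_{u∈T} c(u)·[μ(D) ∫_{D∩{s↔u}} f(C_s) − (∫_D f(C_s)) μ(D∩{s↔u})] + c₀·[μ(D) ∫_{D∩Hub} f(C_s) − (∫_D f(C_s)) μ(D∩Hub)]`,
`Hub = {Σ ↔ s} ∩ {Σ ↮ X}`.  (`BHK2006_clusterJointTestCov_nonneg_of_within` for the joint test
`Σ_u c(u)·1{s↔u} + c₀·1{Σ↔s}·1{Σ↮X}`, decreasing in the cluster of `X` because `c₀ ≥ 0`.)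
[cite: VandenbergHaggstromKahn2005, §2.1 pp. 10–13 (the chain) and Lemma 2.4 (p. 10) — corollary, derived here] -/
theorem BHK2006_multiMarkerHubCov_nonneg_of_within (w : Sym2 V → unitInterval) (s : V) (X : Set V)
    (hX : ∀ e : Sym2 V, ¬ e.IsDiag → (∃ v ∈ e, v ∈ X) → (w e : ℝ) < 1) (T : Finset V) (c : V → ℝ)
    (Sig : Set V) (c₀ : ℝ) (hc₀ : 0 ≤ c₀)
    (hR : ∀ g : Set (Sym2 V) → ℝ, Monotone g → (∀ C, 0 ≤ g C) →
      0 ≤ ∫ ω in {ω : BondConfig V | ∀ x ∈ X, ¬ (openGraph ω).Reachable s x},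
        ((∑ u ∈ T, c u * ((∫ η in (openConn s u : Set (BondConfig V)), g (openEdgeCluster η s)
                ∂(prodBernoulli fun e => if (∃ v ∈ e, ∃ x ∈ X, (openGraph ω).Reachable x v)
                  then (0 : unitInterval) else w e)) -
              (∫ η, g (openEdgeCluster η s)
                ∂(prodBernoulli fun e => if (∃ v ∈ e, ∃ x ∈ X, (openGraph ω).Reachable x v)
                  then (0 : unitInterval) else w e)) *
              (prodBernoulli fun e => if (∃ v ∈ e, ∃ x ∈ X, (openGraph ω).Reachable x v)
                  then (0 : unitInterval) else w e).real (openConn s u : Set (BondConfig V)))) +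
          c₀ * ((if (∀ z ∈ Sig, ∀ x ∈ X, ¬ (openGraph ω).Reachable x z) then (1 : ℝ) else 0) *
            ((∫ η in {η : BondConfig V | ∃ z ∈ Sig, (openGraph η).Reachable s z}, g (openEdgeCluster η s)
                ∂(prodBernoulli fun e => if (∃ v ∈ e, ∃ x ∈ X, (openGraph ω).Reachable x v)
                  then (0 : unitInterval) else w e)) -
              (∫ η, g (openEdgeCluster η s)
                ∂(prodBernoulli fun e => if (∃ v ∈ e, ∃ x ∈ X, (openGraph ω).Reachable x v)
                  then (0 : unitInterval) else w e)) *
              (prodBernoulli fun e => if (∃ v ∈ e, ∃ x ∈ X, (openGraph ω).Reachable x v)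
                  then (0 : unitInterval) else w e).real
                {η : BondConfig V | ∃ z ∈ Sig, (openGraph η).Reachable s z})))
        ∂(prodBernoulli w))
    (f : Set (Sym2 V) → ℝ) (hf : Monotone f) :
    0 ≤ (∑ u ∈ T, c u *
        ((prodBernoulli w).real {ω : BondConfig V | ∀ x ∈ X, ¬ (openGraph ω).Reachable s x} *
            (∫ ω in {ω : BondConfig V | ∀ x ∈ X, ¬ (openGraph ω).Reachable s x} ∩ openConn s u,
              f (openEdgeCluster ω s) ∂(prodBernoulli w)) -
          (∫ ω in {ω : BondConfig V | ∀ x ∈ X, ¬ (openGraph ω).Reachable s x},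
              f (openEdgeCluster ω s) ∂(prodBernoulli w)) *
            (prodBernoulli w).real
              ({ω : BondConfig V | ∀ x ∈ X, ¬ (openGraph ω).Reachable s x} ∩ openConn s u))) +
      c₀ * ((prodBernoulli w).real {ω : BondConfig V | ∀ x ∈ X, ¬ (openGraph ω).Reachable s x} *
          (∫ ω in {ω : BondConfig V | ∀ x ∈ X, ¬ (openGraph ω).Reachable s x} ∩
              {ω | (∃ z ∈ Sig, (openGraph ω).Reachable s z) ∧ ∀ z ∈ Sig, ∀ x ∈ X, ¬ (openGraph ω).Reachable x z},
            f (openEdgeCluster ω s) ∂(prodBernoulli w)) -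
        (∫ ω in {ω : BondConfig V | ∀ x ∈ X, ¬ (openGraph ω).Reachable s x},
            f (openEdgeCluster ω s) ∂(prodBernoulli w)) *
          (prodBernoulli w).real ({ω : BondConfig V | ∀ x ∈ X, ¬ (openGraph ω).Reachable s x} ∩
            {ω | (∃ z ∈ Sig, (openGraph ω).Reachable s z) ∧ ∀ z ∈ Sig, ∀ x ∈ X, ¬ (openGraph ω).Reachable x z})) := by
  set H : Set (Sym2 V) → Set (Sym2 V) → ℝ := fun C B =>
    (∑ u ∈ T, c u * (if (u = s ∨ ∃ e ∈ C, u ∈ e) then (1 : ℝ) else 0)) +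
      c₀ * ((if (∃ z ∈ Sig, z = s ∨ ∃ e ∈ C, z ∈ e) then (1 : ℝ) else 0) *
        (if (∀ z ∈ Sig, ¬ (z ∈ X ∨ ∃ e ∈ B, z ∈ e)) then (1 : ℝ) else 0)) with hH
  -- the joint test is decreasing in the conditioning cluster (`c₀ ≥ 0`)
  have hanti : ∀ A, Antitone (H A) := by
    intro A B B' hBB'
    simp only [hH]
    refine add_le_add le_rfl (mul_le_mul_of_nonneg_left (mul_le_mul_of_nonneg_left ?_ ?_) hc₀)
    · by_cases h' : ∀ z ∈ Sig, ¬ (z ∈ X ∨ ∃ e ∈ B', z ∈ e)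
      · have h'' : ∀ z ∈ Sig, ¬ (z ∈ X ∨ ∃ e ∈ B, z ∈ e) := fun z hz hor =>
          h' z hz (hor.imp id fun ⟨e, he, hze⟩ => ⟨e, hBB' he, hze⟩)
        rw [if_pos h', if_pos h'']
      · rw [if_neg h']
        split_ifs <;> norm_num
    · split_ifs <;> norm_num
  have main := BHK2006_clusterJointTestCov_nonneg_of_within w s X hX H hanti
    (fun g hg hg0 => by
      rw [funext (hub_fresh_eq w s X T c Sig c₀ g)]
      exact hR g hg hg0) f hf
  rw [hub_conclusion_eq w s X T c Sig c₀ f] at main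
  exact main

end Hub

end Literature.Probability.Percolation

end
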